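import Summits.NavierStokesRegularity.NavierStokesRegularity.Theorems.PoloidalWindowDoorPoloidalWindowRigiditySparseEnergyPressureSplitNear
import Summits.NavierStokesRegularity.NavierStokesRegularity.Theorems.PoloidalWindowDoorPoloidalWindowRigiditySparseEnergyPressureSplitFar
import Summits.NavierStokesRegularity.NavierStokesRegularity.Theorems.PoloidalWindowDoorPoloidalWindowRigiditySparseEnergyFarOscillation
import HarnessLib

/-!
# CoriolisHeadLocalEnergyRieszPressureBMO — crux `NoCoRotatingCore` (stmt-NavierStokesRegularity-22676), line
# `local_energy_rescue` (crux workfile, ns-idea-10 g3), stub S1 `stub_driftNormalForm`: THE RIESZ PRESSURE OF A BOUNDED FIELD IS `BMO₂`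

`LocalEnergyRescue.exists_sq_oscillation_pressurePotentialMod_le`: there is a universal `κ ≥ 0` such that for every smooth
field `u : ℝ³ → ℝ³` with `‖u‖ ≤ N`, every base point `x₀`, centre `z` and radius `ρ > 0`,

  `∫_{B(z,ρ)} (Q̃(y) − m)² dy ≤ κ N⁴ ρ³`  for some `m`,  `Q̃ = pressurePotentialMod x₀ u`

(the tree's Riesz pressure `RᵢRⱼ(uᵢuⱼ)` of a bounded field modulo constants, `Literature/Analysis/FluidPDE/RieszPressureModConst`).
This is the quadratic (`BMO₂`) form of the Calderón–Zygmund bound «`RᵢRⱼ : L^∞ → BMO`» (Grafakos, *Modern Fourier Analysis*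
(2009), Cor. 3.4.10; Seregin 2014, Lemma 6.5), and it is ASSEMBLED, not rebuilt, from the window pressure split of the route
`PoloidalWindowDoor` (line `sparse_energy`, seats ns-es-p1 / ns-poloidal-K2-p2): on `B̄(z, 2R)`, `R = ρ/2`,
`Q̃ = c + Q[w] + p₂` with `w = cutoff(4R)(z − ·) • u` (`exists_pressurePotentialMod_split`), the near part has Stein's `L²` bound
`∫_{B̄(z,2R)} Q[w]² ≤ κ₁² N² ∫ cutoff(8R)(z−·)‖u‖² ≤ 4096 κ₁² N⁴ |B₁| R³` (`exists_sqrt_setIntegral_sq_pressurePotential_cutField_le`,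
`integral_cutoff_mul_norm_sq_le`), and the harmonic remainder oscillates by at most
`64 M R Σ'_k (2^kR)⁻⁴ ∫ cutoff(2^{k+1}R)(z−·)‖u‖² ≤ 8192 M N² |B₁|` (`abs_farSplit_sub_le`, the dyadic energies of a bounded field
summing to `≤ 128 N² |B₁| / R`).

HONEST FRAMING.  Potential theory of bounded fields; helper for an unregistered line; nothing here is a statement about
Navier–Stokes regularity.

References: L. Grafakos, *Modern Fourier Analysis*, 2nd ed. (2009), Cor. 3.4.10, Rem. 3.4.11 [GrafakosMFA2009]; G. Seregin,
*Lecture Notes on Regularity Theory for the Navier–Stokes Equations* (2014), §6.2 Lemma 6.5 [Seregin2014]; E. M. Stein,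
*Singular Integrals* (1970), Ch. II §4.2 Thm 3 [Stein1970].
-/

noncomputable section

open MeasureTheory Set Function Filter Topology Metric InnerProductSpace Real
open scoped RealInnerProductSpace ContDiff Topology

-- the crux's namespace is already a prefix of the route's; silence the duplicate-namespace linter as the sibling files do
set_option linter.dupNamespace false

-- nested operator types `ℝ³ →L[ℝ] ℝ³ →L[ℝ] ℝ³ →L[ℝ] ℝ`
set_option maxSynthPendingDepth 3

namespace Summit.NavierStokesRegularity.NavierStokesRegularity.Theorems.CoriolisHead

namespace LocalEnergyRescue

open Literature.Analysis Literature.Analysis.FluidPDE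
open Summit.NavierStokesRegularity.NavierStokesRegularity.Theorems.PoloidalWindowDoorPoloidalWindowRigiditySparseEnergyPressureSplitNear
open Summit.NavierStokesRegularity.NavierStokesRegularity.Theorems.PoloidalWindowDoorPoloidalWindowRigiditySparseEnergyPressureSplitFar
open Summit.NavierStokesRegularity.NavierStokesRegularity.Theorems.PoloidalWindowDoorPoloidalWindowRigiditySparseEnergyFarOscillation

/-- **The dyadic energies of a bounded field sum to `≤ 128 N² |B₁| / R`**: each term
`(2^kR)⁻⁴ ∫ cutoff(2^{k+1}R)(a−y)‖u y‖² dy ≤ (64 N² |B₁| / R) 2⁻ᵏ` (`integral_cutoff_mul_norm_sq_le`). [folklore] -/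
theorem tsum_dyadicEnergy_le {u : EuclideanSpace ℝ (Fin 3) → EuclideanSpace ℝ (Fin 3)} {N : ℝ}
    (hN : ∀ y, ‖u y‖ ≤ N) {R : ℝ} (hR : 0 < R) (a : EuclideanSpace ℝ (Fin 3)) :
    ∑' k : ℕ, ((2 : ℝ) ^ k * R)⁻¹ ^ 4 * ∫ y, cutoff ((2 : ℝ) ^ (k + 1) * R) (a - y) * ‖u y‖ ^ 2 ≤
      128 * N ^ 2 * (volume : Measure (EuclideanSpace ℝ (Fin 3))).real (ball 0 1) / R := by
  set V : ℝ := (volume : Measure (EuclideanSpace ℝ (Fin 3))).real (ball 0 1) with hV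
  have hterm : ∀ k : ℕ, ((2 : ℝ) ^ k * R)⁻¹ ^ 4 * ∫ y, cutoff ((2 : ℝ) ^ (k + 1) * R) (a - y) * ‖u y‖ ^ 2 ≤
      (64 * N ^ 2 * V / R) * (1 / 2) ^ k := by
    intro k
    have h2k : 0 < (2 : ℝ) ^ k := pow_pos two_pos k
    have hρ : 0 < (2 : ℝ) ^ (k + 1) * R := by positivity
    calc ((2 : ℝ) ^ k * R)⁻¹ ^ 4 * ∫ y, cutoff ((2 : ℝ) ^ (k + 1) * R) (a - y) * ‖u y‖ ^ 2
        ≤ ((2 : ℝ) ^ k * R)⁻¹ ^ 4 * (N ^ 2 * ((2 * ((2 : ℝ) ^ (k + 1) * R)) ^ 3 * V)) := by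
          gcongr
          exact integral_cutoff_mul_norm_sq_le hN hρ a
      _ = (64 * N ^ 2 * V / R) * (1 / 2) ^ k := by
          rw [one_div_pow, pow_succ]
          field_simp
          ring
  have hgeo : Summable fun k : ℕ => (64 * N ^ 2 * V / R) * (1 / 2 : ℝ) ^ k :=
    (summable_geometric_of_lt_one (by norm_num) (by norm_num)).mul_left _
  calc ∑' k : ℕ, ((2 : ℝ) ^ k * R)⁻¹ ^ 4 * ∫ y, cutoff ((2 : ℝ) ^ (k + 1) * R) (a - y) * ‖u y‖ ^ 2
      ≤ ∑' k : ℕ, (64 * N ^ 2 * V / R) * (1 / 2 : ℝ) ^ k :=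
        (summable_dyadicEnergy hN hR a).tsum_le_tsum hterm hgeo
    _ = (64 * N ^ 2 * V / R) * 2 := by rw [tsum_mul_left, tsum_geometric_two]
    _ = 128 * N ^ 2 * V / R := by ring

/-- **The Riesz pressure of a bounded smooth field has bounded quadratic mean oscillation (`BMO₂`).**  There is `κ ≥ 0` with:
for every smooth `u : ℝ³ → ℝ³` with `‖u‖ ≤ N`, every base point `x₀`, centre `z` and radius `ρ > 0` there is `m` with
`∫_{B(z,ρ)} (pressurePotentialMod x₀ u y − m)² dy ≤ κ N⁴ ρ³`.  Assembled from the window pressure split at scale `R = ρ/2`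
(`exists_pressurePotentialMod_split`), Stein's `L²` bound for the near part (`exists_sqrt_setIntegral_sq_pressurePotential_cutField_le`)
and the kernel bound for the oscillation of the harmonic remainder (`abs_farSplit_sub_le`, `tsum_dyadicEnergy_le`).
[cite: GrafakosMFA2009, Corollary 3.4.10 and Remark 3.4.11] [cite: Seregin2014, §6.2 Lemma 6.5] -/
theorem exists_sq_oscillation_pressurePotentialMod_le :
    ∃ κ : ℝ, 0 ≤ κ ∧ ∀ (u : EuclideanSpace ℝ (Fin 3) → EuclideanSpace ℝ (Fin 3)) (N : ℝ),
      ContDiff ℝ ∞ u → (∀ y, ‖u y‖ ≤ N) → ∀ (x₀ z : EuclideanSpace ℝ (Fin 3)) (ρ : ℝ), 0 < ρ →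
        ∃ m : ℝ, ∫ y in ball z ρ, (pressurePotentialMod x₀ u y - m) ^ 2 ≤ κ * N ^ 4 * ρ ^ 3 := by
  obtain ⟨κ₁, hκ₁0, hnear⟩ := exists_sqrt_setIntegral_sq_pressurePotential_cutField_le
  obtain ⟨M, hM0, hM⟩ := exists_norm_fderiv3_newtonKernel_le
  set V : ℝ := (volume : Measure (EuclideanSpace ℝ (Fin 3))).real (ball 0 1) with hV
  have hV0 : 0 ≤ V := measureReal_nonneg
  refine ⟨1024 * κ₁ ^ 2 * V + 2 * (8192 * M * V) ^ 2 * V, by positivity, fun u N hu hN x₀ z ρ hρ => ?_⟩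
  have hN0 : 0 ≤ N := (norm_nonneg _).trans (hN 0)
  -- the split at scale `R = ρ / 2`
  set R : ℝ := ρ / 2 with hRdef
  have hR : 0 < R := by positivity
  have h2R : 2 * R = ρ := by rw [hRdef]; ring
  obtain ⟨c, hc⟩ := exists_pressurePotentialMod_split hR hu hN z x₀
  obtain ⟨hQi, hQle⟩ := hnear u N hu hN z R hR
  have hfar : ∀ {x y : EuclideanSpace ℝ (Fin 3)}, x ∈ closedBall z (2 * R) → y ∈ closedBall z (2 * R) →
      |(farPotential (R * 1) (R * 2) (fun y => cutoff (4 * R) (z - y) • u y) x - farPotentialMod (R * 1) (R * 2) x₀ u x) -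
        (farPotential (R * 1) (R * 2) (fun y => cutoff (4 * R) (z - y) • u y) y - farPotentialMod (R * 1) (R * 2) x₀ u y)| ≤
      64 * M * R * ∑' k : ℕ, ((2 : ℝ) ^ k * R)⁻¹ ^ 4 * ∫ y, cutoff ((2 : ℝ) ^ (k + 1) * R) (z - y) * ‖u y‖ ^ 2 :=
    fun hx hy => abs_farSplit_sub_le (r₀ := R * 1) (r₁ := R * 2) (by positivity) (by nlinarith) hR (by nlinarith)
      hu.continuous hN z x₀ hM0 hM hx hy
  set w : EuclideanSpace ℝ (Fin 3) → EuclideanSpace ℝ (Fin 3) := fun y => cutoff (4 * R) (z - y) • u y with hw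
  set p₂ : EuclideanSpace ℝ (Fin 3) → ℝ := fun x =>
    farPotential (R * 1) (R * 2) w x - farPotentialMod (R * 1) (R * 2) x₀ u x with hp₂
  -- the near part
  have hcut : ∫ x, cutoff (8 * R) (z - x) * ‖u x‖ ^ 2 ≤ N ^ 2 * ((2 * (8 * R)) ^ 3 * V) :=
    integral_cutoff_mul_norm_sq_le hN (by positivity) z
  have hQ2 : ∫ x in closedBall z (2 * R), (pressurePotential w x) ^ 2 ≤ 512 * κ₁ ^ 2 * V * N ^ 4 * ρ ^ 3 := by
    have h0 : 0 ≤ ∫ x in closedBall z (2 * R), (pressurePotential w x) ^ 2 :=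
      integral_nonneg fun x => sq_nonneg _
    have h1 : ∫ x in closedBall z (2 * R), (pressurePotential w x) ^ 2 ≤
        (κ₁ * N * Real.sqrt (∫ x, cutoff (8 * R) (z - x) * ‖u x‖ ^ 2)) ^ 2 := by
      rw [← Real.sq_sqrt h0]
      exact pow_le_pow_left₀ (Real.sqrt_nonneg _) hQle 2
    have hI0 : 0 ≤ ∫ x, cutoff (8 * R) (z - x) * ‖u x‖ ^ 2 :=
      integral_nonneg fun x => mul_nonneg (cutoff_nonneg _ _) (sq_nonneg _)
    calc ∫ x in closedBall z (2 * R), (pressurePotential w x) ^ 2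
        ≤ (κ₁ * N) ^ 2 * ∫ x, cutoff (8 * R) (z - x) * ‖u x‖ ^ 2 := by
          rw [mul_pow, Real.sq_sqrt hI0] at h1; exact h1
      _ ≤ (κ₁ * N) ^ 2 * (N ^ 2 * ((2 * (8 * R)) ^ 3 * V)) := mul_le_mul_of_nonneg_left hcut (sq_nonneg _)
      _ = 512 * κ₁ ^ 2 * V * N ^ 4 * ρ ^ 3 := by rw [hRdef]; ring
  have hQball : ∫ y in ball z ρ, (pressurePotential w y) ^ 2 ≤ 512 * κ₁ ^ 2 * V * N ^ 4 * ρ ^ 3 := by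
    calc ∫ y in ball z ρ, (pressurePotential w y) ^ 2
        ≤ ∫ y in closedBall z (2 * R), (pressurePotential w y) ^ 2 := by
          rw [h2R]
          exact setIntegral_mono_set hQi.integrableOn (ae_of_all _ fun y => sq_nonneg _)
            ball_subset_closedBall.eventuallyLE
      _ ≤ 512 * κ₁ ^ 2 * V * N ^ 4 * ρ ^ 3 := hQ2
  -- the oscillation of the harmonic remainder on `B̄(z, 2R)`
  have hT := tsum_dyadicEnergy_le hN hR z
  set O : ℝ := 8192 * M * V * N ^ 2 with hO
  have hosc : ∀ x ∈ closedBall z (2 * R), |p₂ x - p₂ z| ≤ O := by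
    intro x hx
    have hz : z ∈ closedBall z (2 * R) := mem_closedBall_self (by positivity)
    have h := hfar hx hz
    calc |p₂ x - p₂ z| ≤ 64 * M * R *
          ∑' k : ℕ, ((2 : ℝ) ^ k * R)⁻¹ ^ 4 * ∫ y, cutoff ((2 : ℝ) ^ (k + 1) * R) (z - y) * ‖u y‖ ^ 2 := h
      _ ≤ 64 * M * R * (128 * N ^ 2 * V / R) := mul_le_mul_of_nonneg_left hT (by positivity)
      _ = O := by rw [hO]; field_simp; ring
  -- pointwise on the ball
  set m : ℝ := c + p₂ z with hm
  have hpt : ∀ y ∈ ball z ρ, (pressurePotentialMod x₀ u y - m) ^ 2 ≤ 2 * (pressurePotential w y) ^ 2 + 2 * O ^ 2 := by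
    intro y hy
    have hy' : y ∈ closedBall z (2 * R) := by rw [h2R]; exact ball_subset_closedBall hy
    have e : pressurePotentialMod x₀ u y - m = pressurePotential w y + (p₂ y - p₂ z) := by
      rw [hc y hy', hm]; ring
    rw [e]
    have h1 : (p₂ y - p₂ z) ^ 2 ≤ O ^ 2 := by
      have := hosc y hy'
      rw [← sq_abs]
      exact pow_le_pow_left₀ (abs_nonneg _) this 2
    nlinarith [sq_nonneg (pressurePotential w y - (p₂ y - p₂ z))]
  -- integrate
  have hQc : Continuous (pressurePotentialMod x₀ u) := continuous_pressurePotentialMod (contDiff_infty.1 hu 2) hN x₀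
  have hli : IntegrableOn (fun y => (pressurePotentialMod x₀ u y - m) ^ 2) (ball z ρ) volume :=
    (((hQc.sub continuous_const).pow 2).continuousOn.integrableOn_compact (isCompact_closedBall z ρ)).mono_set
      ball_subset_closedBall
  have hci : IntegrableOn (fun _ : EuclideanSpace ℝ (Fin 3) => 2 * O ^ 2) (ball z ρ) volume :=
    integrableOn_const (measure_ball_lt_top.ne)
  have hQi2 : IntegrableOn (fun y => 2 * (pressurePotential w y) ^ 2) (ball z ρ) volume :=
    (hQi.const_mul 2).integrableOn
  have hri : IntegrableOn (fun y => 2 * (pressurePotential w y) ^ 2 + 2 * O ^ 2) (ball z ρ) volume := hQi2.add hci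
  have hvol : volume.real (ball z ρ) = ρ ^ 3 * V := by
    rw [hV, measureReal_def, measureReal_def, Measure.addHaar_ball volume z hρ.le, finrank_euclideanSpace_fin,
      ENNReal.toReal_mul, ENNReal.toReal_ofReal (by positivity)]
  have hsplit : ∫ y in ball z ρ, (2 * (pressurePotential w y) ^ 2 + 2 * O ^ 2) =
      2 * (∫ y in ball z ρ, (pressurePotential w y) ^ 2) + 2 * O ^ 2 * (ρ ^ 3 * V) := by
    rw [integral_add hQi2 hci, integral_const_mul, setIntegral_const, smul_eq_mul, hvol]
    ring
  refine ⟨m, ?_⟩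
  calc ∫ y in ball z ρ, (pressurePotentialMod x₀ u y - m) ^ 2
      ≤ ∫ y in ball z ρ, (2 * (pressurePotential w y) ^ 2 + 2 * O ^ 2) :=
        setIntegral_mono_on hli hri measurableSet_ball hpt
    _ = 2 * (∫ y in ball z ρ, (pressurePotential w y) ^ 2) + 2 * O ^ 2 * (ρ ^ 3 * V) := hsplit
    _ ≤ 2 * (512 * κ₁ ^ 2 * V * N ^ 4 * ρ ^ 3) + 2 * O ^ 2 * (ρ ^ 3 * V) := by nlinarith [hQball]
    _ = (1024 * κ₁ ^ 2 * V + 2 * (8192 * M * V) ^ 2 * V) * N ^ 4 * ρ ^ 3 := by rw [hO]; ring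

end LocalEnergyRescue

end Summit.NavierStokesRegularity.NavierStokesRegularity.Theorems.CoriolisHead

end
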